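import Mathlib.GroupTheory.Index
import Mathlib.GroupTheory.OrderOfElement
import Mathlib.RingTheory.Coprime.Lemmas
import Literature.AnabelianGeometry.AbsoluteAnabelian.AbsTopITemperedCusps

/-!
# [AbsTopI] Prop 4.10 (iii), (v) — statements-first SUB-DAG over the co-free completion of §0

S. Mochizuki, *Topics in Absolute Anabelian Geometry I: Generalities*, J. Math. Sci. Univ. Tokyo
19 (2012) [AbsTopI], §0 p. 8 (co-free / minimal co-free subgroups; the (Q,Δ)-co-free completion
`Π^{Q/co-fr} := lim_H Im_Q(Π/H^{co-fr})`) and Prop 4.10 (iii), (v) pp. 60–61 (manuscript pages,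
lit key `paper:url-11ac98ba15fc`, read on the page); the proof of (v) "amount[s] to summaries of
the relevant portions of the proof of [Mzk10], Corollary 3.11", i.e. of S. Mochizuki,
*Semi-graphs of anabelioids*, Publ. RIMS 42 (2006) [SemiAnbd] pp. 47–48 (`paper:url-f33ace170ff4`,
read on the page).  Sub-DAG table of record: `HOME/plan/L4/SUBDAG-AbsTopI-Prop410.md`.
abc-iut-L4-t4's `AbsTopITemperedCusps.lean` types (i)(ii) (pointer), (iv), (vi) and records that
(iii), (v) "need the co-free completion as a construction"; that CONSTRUCTION (with proofs) is
abc-iut-L4-t13's `AbsTopI/CoFreeCompletion*.lean`, whose OUTPUTS are consumed here through the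
records `CoFreeLKit` (the family `H ↦ H[l]` of (iv) with the conjugation action of normalizers) and
`CoFreeQKit` (the completion w.r.t. a quotient of `Π̂`) — INSTANTIATED at the construction in
`AbsTopIProp410CoFreeBridge.lean` (`CoFreeLKit.ofConstruction`, `CoFreeQKit.ofConstruction`) — and
`ReductionGraphKit` (vertices of the dual graph `Γ_H` of the stable reduction of `X_H` with their
verticial subgroups in `H[l]`; [SemiAnbd] Ex. 3.10, Thm 3.7; TODO-merge:abc-iut-L3).  One
`def … : Prop` per sub-DAG row: (v) `CharacterisesP`, node `Prop410v`, rows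
`MaxCompactAreVerticial`, `FixesOfOuterTrivial`, `VertexInertiaPPower`, `ExistsInertPCovering`, and
the PROVED assembly `prop410v_of_rows`; (iii) — for a de-cuspidalization between tempered CURVES
of abc-iut-L3's `TemperedCurve` (de-orbification, Def. 4.2 (i)(d): TODO(general form)) — node
`Prop410iii` (+ `Prop410iiiDelta`), rows `SelfCompletion`, `DeCuspidalization.Surjective` (see its
NOTE: print's tempered clause is DENSITY — `DeCuspidalization.Dense`, `AbsTopIProp410SubRows.lean`),
`CoFreeCompatAlong`, `CoFreeCofinalAlong` (see its NOTE, finding F-w5d011-1).  NOTE (erratum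
E-L4-7, OURS): under the v1 (precompact) topology of `AbsTopI.CoFreeCompletion` the at-construction
instances `SelfCompletionAt`/`Prop410iiiAt`/`Prop410iiiDeltaAt` of these rows were FALSE-AS-TYPED at
genuine tempered data (kernel witness abc-iut-L6-t21, A21g5-F1); repair R1 (landed, E-L4-7
CLOSED 2026-08-26) re-topologised the construction by the quotient topologies of `Π/K_H`; the
kit-relative rows here were never affected.  Nothing is asserted.  HONEST FRAMING: refereed
prerequisite papers; no bearing on [IUTchIII] Cor. 3.12.
-/

noncomputable section

open scoped Pointwise

namespace Literature.AnabelianGeometry.AbsoluteAnabelian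

open Literature.AnabelianGeometry.SemiGraphs

namespace AbsTopI.Prop410

variable {p : ℕ} [Fact p.Prime]

/-! ### §A. Outputs of the co-free completion ([AbsTopI] §0 p. 8) consumed below -/

/-- KIT (TODO-merge:abc-iut-L4-t13): the family `(H, l) ↦ H[l]` of [AbsTopI] Prop 4.10 (iv)
p. 60 ("the co-free completion of `J` with respect to the maximal pro-`l` quotient of the profinite
completion of `J`"; §0 p. 8: "a natural dense homomorphism `Π → Π^{Q/co-fr}`"), with the action by
CONJUGATION of the normalizer of `H` on `H[l]` (functoriality; `H` acts by inner automorphisms)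
— "the outer action of `J` on `H[l_i]`" of (v).  `Hl H l` is meaningful for `H ≤ Δ^tp_X` open of
finite index and `l` prime (elsewhere junk, unused). [cite: MochizukiAbsTopI2012, §0 p.8] -/
structure CoFreeLKit (X : TemperedCurve p) : Type 1 where
  /-- `H[l]` -/
  Hl : Subgroup X.PiTemp → ℕ → Type
  /-- … a group -/
  [group : ∀ H l, Group (Hl H l)]
  /-- … a topological space -/
  [topologicalSpace : ∀ H l, TopologicalSpace (Hl H l)]
  /-- … a topological group -/
  [isTopologicalGroup : ∀ H l, IsTopologicalGroup (Hl H l)]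
  /-- the natural (dense) homomorphism `H → H[l]` -/
  η : ∀ (H : Subgroup X.PiTemp) (l : ℕ), H →* Hl H l
  /-- the endomorphism of `H[l]` induced by conjugation by `j ∈ N(H)` -/
  conjAct : ∀ (H : Subgroup X.PiTemp) (l : ℕ) (j : X.PiTemp),
    j ∈ Subgroup.normalizer (H : Set X.PiTemp) → (Hl H l →* Hl H l)
  /-- compatibility with `η`: `conjAct j (η h) = η (j h j⁻¹)` -/
  conjAct_η : ∀ (H : Subgroup X.PiTemp) (l : ℕ) (j : X.PiTemp)
    (hj : j ∈ Subgroup.normalizer (H : Set X.PiTemp)) (h : H),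
    conjAct H l j hj (η H l h) =
      η H l ⟨j * (h : X.PiTemp) * j⁻¹,
        (Subgroup.mem_normalizer_iff.mp hj (h : X.PiTemp)).mp h.2⟩
  /-- `H` acts by INNER automorphisms of `H[l]` -/
  conjAct_inner : ∀ (H : Subgroup X.PiTemp) (l : ℕ) (h : X.PiTemp) (hh : h ∈ H) (x : Hl H l),
    conjAct H l h (Subgroup.le_normalizer hh) x = η H l ⟨h, hh⟩ * x * (η H l ⟨h, hh⟩)⁻¹

attribute [instance] CoFreeLKit.group CoFreeLKit.topologicalSpace CoFreeLKit.isTopologicalGroup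
/-- KIT (TODO-merge:abc-iut-L3, [SemiAnbd] Ex. 3.10 / Thm 3.7): the vertices of the dual graph
`Γ_H` "of the special fiber of a stable model of the covering … corresponding to `H`" ([AbsTopI]
Prop 4.10 (iv) p. 60), the action of the normalizer of `H` on them (`H` acting trivially), and a
verticial subgroup `Π_v ⊆ H[l]` per vertex. [cite: MochizukiAbsTopI2012, Prop 4.10 (iv) p.60] -/
structure ReductionGraphKit (X : TemperedCurve p) (K : CoFreeLKit X) : Type 1 where
  /-- the set of vertices of `Γ_H` -/
  V : Subgroup X.PiTemp → Type
  /-- the action of `j ∈ N(H)` on the vertices of `Γ_H` -/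
  act : ∀ (H : Subgroup X.PiTemp) (j : X.PiTemp),
    j ∈ Subgroup.normalizer (H : Set X.PiTemp) → V H → V H
  /-- `H` acts trivially on `Γ_H` -/
  act_eq_self_of_mem : ∀ (H : Subgroup X.PiTemp) (h : X.PiTemp) (hh : h ∈ H) (v : V H),
    act H h (Subgroup.le_normalizer hh) v = v
  /-- a verticial subgroup `Π_v ⊆ H[l]` of the vertex `v` -/
  vert : ∀ (H : Subgroup X.PiTemp) (l : ℕ), V H → Subgroup (K.Hl H l)
/-- "an open subgroup `H ⊆ Δ^tp_X` of finite index" ([AbsTopI] Prop 4.10 (iv)–(vi)): `H ⊆ Δ^tp_X`,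
open IN `Δ^tp_X` (subspace topology; `Δ^tp_X` is closed of infinite index in `Π^tp_X`) and of finite
index in `Δ^tp_X`. [cite: MochizukiAbsTopI2012, Prop 4.10 (iv) p.60] -/
def IsOpenFiniteIndexInDelta (X : TemperedCurve p) (H : Subgroup X.PiTemp) : Prop :=
  H ≤ X.DeltaTemp ∧
    IsOpen ((H.subgroupOf X.DeltaTemp : Subgroup X.DeltaTemp) : Set X.DeltaTemp) ∧
      (H.subgroupOf X.DeltaTemp).FiniteIndex
/-- "maximal compact subgroup" (of `H[l]`, [AbsTopI] Prop 4.10 (iv)/(v)): compact and equal to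
every compact subgroup containing it (the clause of abc-iut-L4-t4's
`VerticialEdgeLikeCharacterized`). [cite: MochizukiAbsTopI2012, Prop 4.10 (iv) p.60] -/
def IsMaxCompactSubgroup {G : Type*} [Group G] [TopologicalSpace G] (M : Subgroup G) : Prop :=
  IsCompact (M : Set G) ∧ ∀ W : Subgroup G, IsCompact (W : Set G) → M ≤ W → M = W
/-- Prop 4.10 (v) (b) for one element `j ∈ N(H)`: the induced automorphism of `H[l]` "fixes [the
conjugacy class in `H[l]` of] and induces the trivial outer action on" `M ⊆ H[l]` — equivalently
(elementary), it restricts on `M` to conjugation by an element of `H[l]`.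
[cite: MochizukiAbsTopI2012, Prop 4.10 (v) p.61] -/
def OuterTrivialOn {X : TemperedCurve p} (K : CoFreeLKit X) (H : Subgroup X.PiTemp) (l : ℕ)
    (M : Subgroup (K.Hl H l)) (j : X.PiTemp)
    (hj : j ∈ Subgroup.normalizer (H : Set X.PiTemp)) : Prop :=
  ∃ u : K.Hl H l, ∀ m ∈ M, K.conjAct H l j hj m = u * m * u⁻¹

/-! ### §C. Prop 4.10 (v): "`p` is the unique prime `l` such that …" -/
/-- The predicate of [AbsTopI] Prop 4.10 (v), p. 61: "there exist open subgroups `H, J ⊆ Δ^tp_X`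
of finite index, together with distinct prime numbers `l₁, l₂`, satisfying …: (a) `H` is a normal
subgroup of `J` of index `l`; (b) for `i = 1, 2`, the outer action of `J` on `H[l_i]` [cf. (iv)]
fixes [the conjugacy class in `H[l_i]` of] and induces the trivial outer action on some maximal
compact subgroup of `H[l_i]`". [cite: MochizukiAbsTopI2012, Prop 4.10 (v) p.61] -/
def CharacterisesP {X : TemperedCurve p} (K : CoFreeLKit X) (l : ℕ) : Prop :=
  ∃ H J : Subgroup X.PiTemp, IsOpenFiniteIndexInDelta X H ∧ IsOpenFiniteIndexInDelta X J ∧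
    ∃ (_ : H ≤ J) (hJN : J ≤ Subgroup.normalizer (H : Set X.PiTemp)),
      (H.subgroupOf J).Normal ∧ H.relIndex J = l ∧
      ∃ l₁ l₂ : ℕ, l₁.Prime ∧ l₂.Prime ∧ l₁ ≠ l₂ ∧
        ∀ l' ∈ ({l₁, l₂} : Set ℕ), ∃ M : Subgroup (K.Hl H l'), IsMaxCompactSubgroup M ∧
          ∀ (j : X.PiTemp) (hj : j ∈ J), OuterTrivialOn K H l' M j (hJN hj)

/-- **[AbsTopI] Prop 4.10 (v)** (NODE `AbsTopI:Prop4.10(v)`, p. 61): "The prime number `p` may be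
characterized — "group-theoretically" — as the unique prime number `l` such that"
`CharacterisesP` holds.  PROVED from the rows in `prop410v_of_rows`.
[cite: MochizukiAbsTopI2012, Prop 4.10 (v) p.61] -/
def Prop410v {X : TemperedCurve p} (K : CoFreeLKit X) : Prop :=
  ∀ l : ℕ, l.Prime → (CharacterisesP K l ↔ l = p)
/-- ROW v.L02 = Prop 4.10 (iv) p. 60 l.−4 – p. 61 l. 2, verticial half (typed (iv) = t4's
`VerticialEdgeLikeCharacterized`): for `l ≠ p`, "the verticial … subgroups of `H[l]` may be
characterized … as the maximal compact subgroups" — maximal compact ⟺ `H[l]`-conjugate of the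
verticial subgroup of a vertex of `Γ_H`. [cite: MochizukiAbsTopI2012, Prop 4.10 (iv) p.60] -/
def MaxCompactAreVerticial {X : TemperedCurve p} (K : CoFreeLKit X)
    (R : ReductionGraphKit X K) : Prop :=
  ∀ (H : Subgroup X.PiTemp), IsOpenFiniteIndexInDelta X H → ∀ l : ℕ, l.Prime → l ≠ p →
    ∀ M : Subgroup (K.Hl H l),
      IsMaxCompactSubgroup M ↔ ∃ (v : R.V H) (u : K.Hl H l), M = MulAut.conj u • R.vert H l v
/-- ROW v.L03 (dictionary; [SemiAnbd] Thm 3.7 (ii)(iii) as used in the proof of Cor. 3.11, p. 48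
l. 8–12, "the decomposition group `D_v` … determined by a vertex `v`"): for `l ≠ p`, if conjugation
by `j ∈ N(H)` is outer-trivial on `Π_v ⊆ H[l]`, then `j` fixes the vertex `v` of `Γ_H` (distinct
vertices have non-conjugate verticial subgroups). [cite: MochizukiSemiAnbd2006, Cor 3.11 proof p.48] -/
def FixesOfOuterTrivial {X : TemperedCurve p} (K : CoFreeLKit X)
    (R : ReductionGraphKit X K) : Prop :=
  ∀ (H : Subgroup X.PiTemp), IsOpenFiniteIndexInDelta X H → ∀ l : ℕ, l.Prime → l ≠ p →
    ∀ (v : R.V H) (j : X.PiTemp) (hj : j ∈ Subgroup.normalizer (H : Set X.PiTemp)),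
      OuterTrivialOn K H l (R.vert H l v) j hj → R.act H j hj v = v
/-- ROW v.L04 = proof of [SemiAnbd] Cor. 3.11, p. 48 l. 8–18: "the inertia group `I_v ⊆ D_v` —
i.e., the subgroup that acts trivially on this anabelioid — is necessarily of order a power of
`p_□`. (… any nontrivial automorphism of an irreducible component of the special fiber … induces
a nontrivial outer automorphism of the tame pro-`Σ` fundamental group …)".  At the kit (`Σ = {l}`,
`l ≠ p`, `Δ′ = H ⊲ J`): a `j ∈ J` fixing `v` and outer-trivial on `Π_v ⊆ H[l]` has `p`-power order
modulo `H`.  FACT-policy content under campaign M. [cite: MochizukiSemiAnbd2006, Cor 3.11 proof p.48] -/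
def VertexInertiaPPower {X : TemperedCurve p} (K : CoFreeLKit X)
    (R : ReductionGraphKit X K) : Prop :=
  ∀ (H J : Subgroup X.PiTemp), IsOpenFiniteIndexInDelta X H → IsOpenFiniteIndexInDelta X J →
    H ≤ J → ∀ (hJN : J ≤ Subgroup.normalizer (H : Set X.PiTemp)), ∀ l : ℕ, l.Prime → l ≠ p →
      ∀ (v : R.V H) (j : X.PiTemp) (hj : j ∈ J), R.act H j (hJN hj) v = v →
        OuterTrivialOn K H l (R.vert H l v) j (hJN hj) → ∃ n : ℕ, j ^ (p ^ n) ∈ H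
/-- ROW v.L05 = EXISTENCE at `l = p`: proof of observation (iv) in the proof of [SemiAnbd]
Cor. 3.11, p. 47 l. 25–42 ("a covering … ramified over the irreducible component `C_□` … such a
`Δ′[□]` always exists: … "multiplication by `p_□` on the Jacobian"") with p. 48 l. 18–19 ("there
exist `Δ′[□]` for which `I_v` is nontrivial"): open finite-index `H ⊲ J ⊆ Δ^tp_X` with `[J : H] = p`
and a vertex `v` of `Γ_H` fixed by `J`, on whose verticial subgroup `J` is outer-trivial in `H[l]`
for every prime `l ≠ p`.  FACT-policy content. [cite: MochizukiSemiAnbd2006, Cor 3.11 proof p.47] -/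
def ExistsInertPCovering {X : TemperedCurve p} (K : CoFreeLKit X)
    (R : ReductionGraphKit X K) : Prop :=
  ∃ H J : Subgroup X.PiTemp, IsOpenFiniteIndexInDelta X H ∧ IsOpenFiniteIndexInDelta X J ∧
    ∃ (_ : H ≤ J) (hJN : J ≤ Subgroup.normalizer (H : Set X.PiTemp)),
      (H.subgroupOf J).Normal ∧ H.relIndex J = p ∧
      ∃ v : R.V H, ∀ (j : X.PiTemp) (hj : j ∈ J), R.act H j (hJN hj) v = v ∧
        ∀ l : ℕ, l.Prime → l ≠ p → OuterTrivialOn K H l (R.vert H l v) j (hJN hj)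
/-- ROW v.L06 (p. 61 l. 34–35: "at least one of the `l_i` is `≠ p`"). PROVED. [folklore] -/
private theorem ne_or_ne_of_ne {l₁ l₂ q : ℕ} (h : l₁ ≠ l₂) : l₁ ≠ q ∨ l₂ ≠ q := by
  omega
/-- Two distinct primes both `≠ q` (two of `2, 3, 5`); for `l = p ⇒ 𝒫(l)`. PROVED. [folklore] -/
private theorem exists_two_primes_ne (q : ℕ) :
    ∃ l₁ l₂ : ℕ, l₁.Prime ∧ l₂.Prime ∧ l₁ ≠ l₂ ∧ l₁ ≠ q ∧ l₂ ≠ q := by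
  by_cases h2 : q = 2
  · exact ⟨3, 5, Nat.prime_three, Nat.prime_five, by norm_num, by omega, by omega⟩
  by_cases h3 : q = 3
  · exact ⟨2, 5, Nat.prime_two, Nat.prime_five, by norm_num, by omega, by omega⟩
  · exact ⟨2, 3, Nat.prime_two, Nat.prime_three, by norm_num, by omega, by omega⟩
/-- Outer-triviality transports from a conjugate `u Π u⁻¹` to `Π`; bookkeeping for (v). [folklore] -/
private theorem outerTrivialOn_of_conj {X : TemperedCurve p} (K : CoFreeLKit X) (H : Subgroup X.PiTemp)
    (l : ℕ) (M : Subgroup (K.Hl H l)) (u : K.Hl H l) (j : X.PiTemp)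
    (hj : j ∈ Subgroup.normalizer (H : Set X.PiTemp))
    (h : OuterTrivialOn K H l (MulAut.conj u • M) j hj) : OuterTrivialOn K H l M j hj := by
  obtain ⟨w, hw⟩ := h
  refine ⟨(K.conjAct H l j hj u)⁻¹ * w * u, fun m hm => ?_⟩
  have hmem : u * m * u⁻¹ ∈ MulAut.conj u • M := ⟨m, hm, by simp [MulAut.conj_apply]⟩
  have key := hw (u * m * u⁻¹) hmem
  rw [map_mul, map_mul, map_inv] at key
  have : K.conjAct H l j hj m =
      (K.conjAct H l j hj u)⁻¹ * (w * (u * m * u⁻¹) * w⁻¹) * K.conjAct H l j hj u := by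
    rw [← key]; group
  rw [this]; group
/-- If `H ⊲ J` has prime index `l`, `j ∈ J`, some `qⁿ`-th power of `j` lies in `H`, and
`l ≠ q`, then `j ∈ H` (Bézout); bookkeeping for the case `l_i ≠ p` of Prop 4.10 (v). [folklore] -/
private theorem mem_of_pow_prime_pow_mem {G : Type*} [Group G] {H J : Subgroup G}
    (hN : (H.subgroupOf J).Normal) {l q : ℕ} (hl : l.Prime) (hq : q.Prime) (hlq : l ≠ q)
    (hidx : H.relIndex J = l) {j : G} (hj : j ∈ J) {n : ℕ} (hpow : j ^ (q ^ n) ∈ H) :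
    j ∈ H := by
  have hl_mem : j ^ l ∈ H := by
    have hmem := Subgroup.pow_index_mem (H.subgroupOf J) ⟨j, hj⟩
    rw [Subgroup.mem_subgroupOf] at hmem
    have hidx' : (H.subgroupOf J).index = l := hidx
    rw [hidx'] at hmem
    exact hmem
  have hcop : Nat.Coprime l (q ^ n) :=
    Nat.Coprime.pow_right n ((Nat.coprime_primes hl hq).mpr hlq)
  obtain ⟨a, b, hab⟩ : IsCoprime (l : ℤ) ((q ^ n : ℕ) : ℤ) := Nat.isCoprime_iff_coprime.mpr hcop
  have hz1 : j ^ ((l : ℤ) * a) ∈ H := by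
    rw [zpow_mul, zpow_natCast]; exact H.zpow_mem hl_mem a
  have hz2 : j ^ (((q ^ n : ℕ) : ℤ) * b) ∈ H := by
    rw [zpow_mul, zpow_natCast]; exact H.zpow_mem hpow b
  have hsum : j ^ ((l : ℤ) * a + ((q ^ n : ℕ) : ℤ) * b) ∈ H := by
    rw [zpow_add]; exact H.mul_mem hz1 hz2
  have hone : (l : ℤ) * a + ((q ^ n : ℕ) : ℤ) * b = 1 := by linarith [hab]
  rw [hone, zpow_one] at hsum
  exact hsum

/-- **Assembly of [AbsTopI] Prop 4.10 (v) from the rows of its printed proof** (p. 61 l. 33–36: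
"at least one of the `l_i` is `≠ p`; thus, for this choice of `l_i`, the action of `J` fixes and
induces the trivial outer action on some verticial subgroup of `H[l_i]`").  PROVED: (⇐) the `ℤ/p`
inside the vertex inertia with two distinct primes `≠ p`; (⇒) for the `l_i ≠ p` the maximal compact
subgroup is a conjugate verticial subgroup, `J` fixes its vertex and is inert there, so every
`j ∈ J` has `j^{pⁿ} ∈ H`; `[J : H] = l` prime, `l ≠ p` force `J = H`, a contradiction.
[cite: MochizukiAbsTopI2012, Prop 4.10 (v) p.61] -/
theorem prop410v_of_rows {X : TemperedCurve p} (K : CoFreeLKit X) (R : ReductionGraphKit X K)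
    (h2 : MaxCompactAreVerticial K R) (h3 : FixesOfOuterTrivial K R)
    (h4 : VertexInertiaPPower K R) (h5 : ExistsInertPCovering K R) : Prop410v K := by
  have hp : p.Prime := Fact.out
  intro l hl
  constructor
  · rintro ⟨H, J, hH, hJ, hHJ, hJN, hN, hidx, l₁, l₂, hl₁, hl₂, hne, hb⟩
    by_contra hlp
    obtain ⟨l', hl'mem, hl'p, hl'⟩ : ∃ l' ∈ ({l₁, l₂} : Set ℕ), l' ≠ p ∧ l'.Prime := by
      rcases ne_or_ne_of_ne (q := p) hne with h | h
      · exact ⟨l₁, by simp, h, hl₁⟩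
      · exact ⟨l₂, by simp, h, hl₂⟩
    obtain ⟨M, hM, hMJ⟩ := hb l' hl'mem
    obtain ⟨v, u, rfl⟩ := (h2 H hH l' hl' hl'p M).mp hM
    have hJH : J ≤ H := by
      intro j hj
      have hout : OuterTrivialOn K H l' (R.vert H l' v) j (hJN hj) :=
        outerTrivialOn_of_conj K H l' (R.vert H l' v) u j (hJN hj) (hMJ j hj)
      have hfix : R.act H j (hJN hj) v = v := h3 H hH l' hl' hl'p v j (hJN hj) hout
      obtain ⟨n, hn⟩ := h4 H J hH hJ hHJ hJN l' hl' hl'p v j hj hfix hout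
      exact mem_of_pow_prime_pow_mem hN hl hp hlp hidx hj hn
    have h1 : H.relIndex J = 1 := Subgroup.relIndex_eq_one.mpr hJH
    rw [hidx] at h1
    exact hl.one_lt.ne' h1
  · intro hlp
    rw [hlp]
    obtain ⟨H, J, hH, hJ, hHJ, hJN, hN, hidx, v, hv⟩ := h5
    obtain ⟨l₁, l₂, hl₁, hl₂, hne, h₁p, h₂p⟩ := exists_two_primes_ne p
    refine ⟨H, J, hH, hJ, hHJ, hJN, hN, hidx, l₁, l₂, hl₁, hl₂, hne, ?_⟩
    intro l' hl'mem
    have hl'p : l' ≠ p ∧ l'.Prime := by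
      simp only [Set.mem_insert_iff, Set.mem_singleton_iff] at hl'mem
      rcases hl'mem with rfl | rfl
      · exact ⟨h₁p, hl₁⟩
      · exact ⟨h₂p, hl₂⟩
    refine ⟨R.vert H l' v, (h2 H hH l' hl'p.2 hl'p.1 _).mpr ⟨v, 1, by simp⟩, fun j hj => ?_⟩
    exact (hv j hj).2 l' hl'p.2 hl'p.1

/-! ### §B. Prop 4.10 (iii): `Π^tp_X → Π^tp_Y` via the co-free completion -/

/-- KIT (TODO-merge:abc-iut-L4-t13): the co-free completion of `(Π^tp_X, Δ^tp_X)` w.r.t. a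
quotient `q : Π̂_X ↠ Q` ([AbsTopI] §0 p. 8) as OUTPUTS: the completion `C`, the dense homomorphism
`η : Π^tp_X → C`, and `H ↦ H^{co-fr}` (minimal co-free subgroup; meaningful for `H ⊆ Δ^tp_X`
characteristic open of finite index, junk elsewhere). [cite: MochizukiAbsTopI2012, §0 p.8] -/
structure CoFreeQKit (X : TemperedCurve p) (Q : Type) [Group Q] [TopologicalSpace Q]
    (q : X.PiHat →ₜ* Q) : Type 1 where
  /-- the completion `(Π^tp_X)^{Q/co-fr}` -/
  C : Type
  /-- … a group -/
  [group : Group C]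
  /-- … a topological space -/
  [topologicalSpace : TopologicalSpace C]
  /-- … a topological group -/
  [isTopologicalGroup : IsTopologicalGroup C]
  /-- the natural dense homomorphism `Π^tp_X → (Π^tp_X)^{Q/co-fr}` -/
  η : X.PiTemp →ₜ* C
  /-- `H ↦ H^{co-fr}` -/
  coFr : Subgroup X.PiTemp → Subgroup X.PiTemp
  /-- `H^{co-fr} ⊆ H` -/
  coFr_le : ∀ H, coFr H ≤ H

attribute [instance] CoFreeQKit.group CoFreeQKit.topologicalSpace CoFreeQKit.isTopologicalGroup

/-- The indexing family of [AbsTopI] §0 p. 8 at `(Π^tp_X, Δ^tp_X)`: characteristic (in `Δ^tp_X`)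
open subgroups of finite index of `Δ^tp_X`. [cite: MochizukiAbsTopI2012, §0 p.8] -/
def IsCharOpenFiniteIndexInDelta (X : TemperedCurve p) (H : Subgroup X.PiTemp) : Prop :=
  IsOpenFiniteIndexInDelta X H ∧ (H.subgroupOf X.DeltaTemp).Characteristic

/-- DATA of ROW iii.L01: a DE-CUSPIDALIZATION `φ : X → Y` of tempered curves ([AbsTopI] Def. 4.2
(i)(c) p. 49: "an open immersion `X ↪ Y` whose image is the complement of a single `k`-valued point
of `Y`"; profinite version: t4's `ChainGroup.IsElemOp .deCusp`): `f` over `G_k`, its profinite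
completion `f̂ : Π̂_X ↠ Π̂_Y`, surjective, with kernel topologically normally generated by the inertia
group of the removed `k`-rational cusp (Def. 4.2 (iii)(c) p. 50).  TODO(general form):
de-orbifications of orbicurves. [cite: MochizukiAbsTopI2012, Def 4.2 (i)(c) p.49] -/
structure DeCuspidalization (X Y : TemperedCurve p) : Type where
  /-- `Π^tp_X → Π^tp_Y` -/
  f : X.PiTemp →ₜ* Y.PiTemp
  /-- `Π̂_X ↠ Π̂_Y` -/
  fHat : X.PiHat →ₜ* Y.PiHat
  /-- compatibility with the profinite completions -/
  toHat_comp : ∀ g : X.PiTemp, Y.toHat (f g) = fHat (X.toHat g)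
  /-- `f` lies over `G_k` -/
  aug_comp : ∀ g : X.PiTemp, Y.aug (f g) = X.aug g
  /-- `f̂` is surjective -/
  fHat_surjective : Function.Surjective fHat
  /-- the removed point … -/
  x : X.Pt
  /-- … is a cusp … -/
  isCusp : X.IsCusp x
  /-- … and `k`-rational: `D_x` surjects onto `G_k` -/
  rational : X.aug '' (X.decomp x : Set X.PiTemp) = Set.range X.aug
  /-- `Ker f̂` is topologically normally generated by the image of the inertia group `I_x` -/
  ker_fHat : fHat.toMonoidHom.ker =
    (Subgroup.normalClosure
      ((X.inertia x).map X.toHat.toMonoidHom : Set X.PiHat)).topologicalClosure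

/-- ROW iii.L03 (OURS; Def. 4.2 (iii)(c) p. 50 "a surjection `Π_j ↠ Π_{j+1}`" is the PROFINITE
clause = field `fHat_surjective`): `f` is surjective and maps `Δ^tp_X` onto `Δ^tp_Y`.  NOTE (L4-lead
RULING #3f): STRONGER THAN PRINT for the tempered `f` — Def. 4.11 (i)(c) pp. 62–63 says "a dense
homomorphism"; the print-faithful row is `DeCuspidalization.Dense` (`AbsTopIProp410SubRows.lean`),
and under `Prop410iii` surjectivity of `f` ⟺ surjectivity of the §0 map `η`
(`Prop410iii.surjective_f_iff`); consumed by no theorem. [cite: MochizukiAbsTopI2012, Def 4.2 (iii) p.50] -/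
def DeCuspidalization.Surjective {X Y : TemperedCurve p} (E : DeCuspidalization X Y) : Prop :=
  Function.Surjective E.f ∧ X.DeltaTemp.map E.f.toMonoidHom = Y.DeltaTemp

/-- ROW iii.L02 = [AbsTopI] Prop 4.10 (i), last clause, p. 60 l. 45–47 ((i)'s injectivity clause
is L3's field `TemperedCurve.toHat_injective`): "`π₁^tp(X)` … is naturally isomorphic to its
`π₁(X)`-co-free completion" — at the kit for `Q := Π̂_Z`, `q := id`.
[cite: MochizukiAbsTopI2012, Prop 4.10 (i) p.60] -/
def SelfCompletion (Z : TemperedCurve p)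
    (kit : CoFreeQKit Z Z.PiHat (ContinuousMonoidHom.id Z.PiHat)) : Prop :=
  ∃ e : kit.C ≃ₜ* Z.PiTemp, ∀ g : Z.PiTemp, e (kit.η g) = g

/-- ROW iii.L04 (the definitional content of "(iii) follows immediately from (i)", p. 61 l. 31, with
p. 60 l. 8–13): for `H` characteristic open of finite index in `Δ^tp_Y`, the minimal co-free subgroup
of `f⁻¹(H)` maps ONTO that of `H` (filling in a cusp does not change the universal covering of the
dual graph). [cite: MochizukiAbsTopI2012, Prop 4.10 (iii) p.60] -/
def CoFreeCompatAlong {X Y : TemperedCurve p} (E : DeCuspidalization X Y)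
    (kitX : CoFreeQKit X Y.PiHat E.fHat)
    (kitY : CoFreeQKit Y Y.PiHat (ContinuousMonoidHom.id Y.PiHat)) : Prop :=
  ∀ H : Subgroup Y.PiTemp, IsCharOpenFiniteIndexInDelta Y H →
    (kitX.coFr (H.comap E.f.toMonoidHom)).map E.f.toMonoidHom = kitY.coFr H

/-- ROW iii.L05 (OURS; §0 p. 8, the limit over characteristic open finite-index `H ⊆ Δ`):
COFINALITY — each such `H ⊆ Δ^tp_X` contains the preimage of such an `H′ ⊆ Δ^tp_Y`, and
`H ↦ H^{co-fr}` is monotone.  NOTE (finding F-w5d011-1, L4-lead RULING #3 (4)(iv)): conjunct 1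
(preimage cofinality) is SUSPECT-TOO-STRONG at the intended data (`f⁻¹(H′) ⊇ I_x`, while a
characteristic `H` may omit the inertia `I_x` of the filled cusp) and is consumed by NO theorem;
the kernel-image form is `CoFreeKernelCofinalAlong` (`AbsTopIProp410SubRows.lean`, proved from
iii.L04 + conjunct 2 + `CharOpenCofinal`) / `CoFreeCofinalImAlong` (`AbsTopIProp410CoFreeBridge.lean`);
conjunct 2 is the theorem `cofreeCore_mono` at the construction. [cite: MochizukiAbsTopI2012, §0 p.8] -/
def CoFreeCofinalAlong {X Y : TemperedCurve p} (E : DeCuspidalization X Y)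
    (kitX : CoFreeQKit X Y.PiHat E.fHat) : Prop :=
  (∀ H : Subgroup X.PiTemp, IsCharOpenFiniteIndexInDelta X H →
      ∃ H' : Subgroup Y.PiTemp, IsCharOpenFiniteIndexInDelta Y H' ∧
        H'.comap E.f.toMonoidHom ≤ H) ∧
    ∀ H₁ H₂ : Subgroup X.PiTemp, IsOpenFiniteIndexInDelta X H₁ → IsOpenFiniteIndexInDelta X H₂ →
      H₁ ≤ H₂ → kitX.coFr H₁ ≤ kitX.coFr H₂

/-- **[AbsTopI] Prop 4.10 (iii)** (NODE `AbsTopI:Prop4.10(iii)`, de-cuspidalization case), p. 60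
l. 40–52: "the natural homomorphism `Π^tp_X → Π^tp_Y` … may be reconstructed … from its profinite
completion `Π̂^tp_X ↠ Π̂^tp_Y` … as the natural morphism from `Π^tp_X` … to the co-free completion of
`Π^tp_X` with respect to `Π̂^tp_Y`": an isomorphism `(Π^tp_X)^{Π̂_Y/co-fr} ⥲ Π^tp_Y` carrying `η` to `f`.
Rows: `SelfCompletion Y`, `E.Surjective`, `CoFreeCompatAlong`, `CoFreeCofinalAlong`.
[cite: MochizukiAbsTopI2012, Prop 4.10 (iii) p.60] -/
def Prop410iii {X Y : TemperedCurve p} (E : DeCuspidalization X Y)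
    (kitX : CoFreeQKit X Y.PiHat E.fHat) : Prop :=
  ∃ e : kitX.C ≃ₜ* Y.PiTemp, ∀ g : X.PiTemp, e (kitX.η g) = E.f g

/-- **[AbsTopI] Prop 4.10 (iii)**, "respectively, `Δ^tp_X → Δ^tp_Y`" (p. 60 l. 46–52): the
isomorphism of `Prop410iii` carries the closure of `η(Δ^tp_X)` onto `Δ^tp_Y`.
[cite: MochizukiAbsTopI2012, Prop 4.10 (iii) p.60] -/
def Prop410iiiDelta {X Y : TemperedCurve p} (E : DeCuspidalization X Y)
    (kitX : CoFreeQKit X Y.PiHat E.fHat) : Prop :=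
  ∃ e : kitX.C ≃ₜ* Y.PiTemp, (∀ g : X.PiTemp, e (kitX.η g) = E.f g) ∧
    (X.DeltaTemp.map kitX.η.toMonoidHom).topologicalClosure.map e.toMonoidHom = Y.DeltaTemp

end AbsTopI.Prop410
end Literature.AnabelianGeometry.AbsoluteAnabelian

end
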